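import Summits.AtomisticToContinuum.HydrodynamicLimit.Theorems.StiffCollisionalRelaxationAprioriBoundsFibreDefs
import Mathlib.InformationTheory.KullbackLeibler.Basic
import HarnessLib

/-!
# Vocabulary of the line `fibre-deficit-transfer` for the crux `AprioriBounds` (stmt-AtomisticToContinuum-14827), part 2:
the rate-free, time-integrated packages of skeleton r4 (cycle 2)

Definitions-only support file (`--supports stmt-AtomisticToContinuum-14827`) of the lead prover of the line; companion of
`…AprioriBoundsFibreDefs` (kept as a separate module so that landing it does not invalidate the farm build of the first one).
Nothing is asserted: every `def … : Prop` is a predicate with parameters that a stub proves or consumes.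
-/

noncomputable section

open MeasureTheory Filter Set Topology
open scoped ENNReal

/-! ## Rate-free, time-integrated packages (skeleton r4, cycle 2)

Component (i) is a TIME AVERAGE, and its assembly consumes bad events only through `∫₀ᵗ P(bad(K,s)) ds`; so every package of the
(i)-chain has a rate-free, time-integrated form, and in that form the statics input is a thermodynamic LIMIT (landed:
`hardSphereLDA_proof`, `JaynesSqueeze*`, `…FibreIsentropy`) and the dynamical input is conjunct-strength hydrodynamics on `[0, t]`. -/

namespace Summit.AtomisticToContinuum.HydrodynamicLimit.Theorems.FibreDeficitTransfer

open Literature.MathematicalPhysics.KineticTheory Literature.Analysis.FluidPDE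
open Summit.AtomisticToContinuum.HydrodynamicLimit.Theorems.VisitLedgerUpscattering (Cfg Flow Flows NiceProfiles)

/-- `IntegratedBulkTailAt` — OUTPUT OF THE RATE-FREE TRANSFER: for some `Θ > 0`, `A`, for every slack `δ > 0` and `ε > 0`, eventually
in `N`, for ALL levels `K`, the TIME-INTEGRATED probability of the bad tail-fraction event is `≤ ε`:
`∫₀ᵗ P_N{ 2A e^{−K/(2Θ)} + δ < frac_K(s) } ds ≤ ε`. -/
def IntegratedBulkTailAt (σ : ℝ) (a₀ θ₀ : T3 → ℝ) (u₀ : T3 → V3) (Φ : Flows σ) (t : ℝ) : Prop :=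
  ∃ Θ A : ℝ, 0 < Θ ∧ ∀ δ : ℝ, 0 < δ → ∀ ε : ℝ, 0 < ε → ∃ N₀ : ℕ, ∀ N : ℕ, N₀ ≤ N → ∀ K : ℝ,
    ∫⁻ s in Icc 0 t, localGibbsLaw σ a₀ u₀ θ₀ N (Φ N)
      {z | 2 * A * Real.exp (-(K / (2 * Θ))) + δ < frac K ((Φ N).flow s z)} ≤ ENNReal.ofReal ε

/-- `FarTailAllAt` — FAR TAILS AT ALL LEVELS WITHOUT POLYNOMIAL SLACK (`FarTailAt` with `r = 0`, `K₀ = 0` and every real `K`): the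
expected time-integrated occupation of `{|v|² ≥ K}` is `≤ t·A·e^{−K/(2Θ)}` eventually in `N`, for ALL `K`.  Producer: an expected Gaussian
velocity moment along the flow (`SpeedCapSurgery.GaussianVelocityTails`, stmt-9633, through Markov–Tonelli). -/
def FarTailAllAt (σ : ℝ) (a₀ θ₀ : T3 → ℝ) (u₀ : T3 → V3) (Φ : Flows σ) (t : ℝ) : Prop :=
  ∃ Θ A : ℝ, 0 < Θ ∧ ∃ N₀ : ℕ, ∀ N : ℕ, N₀ ≤ N → ∀ K : ℝ,
    ∫⁻ z, (∫⁻ s in Icc 0 t, ENNReal.ofReal (frac K ((Φ N).flow s z))) ∂(localGibbsLaw σ a₀ u₀ θ₀ N (Φ N)) ≤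
      ENNReal.ofReal (t * A * Real.exp (-(K / (2 * Θ))))

/-- `KLIntegratedVanishAt` — TIME-INTEGRATED RELATIVE-ENTROPY HYDRODYNAMICS against local Gibbs references with activities `b s` and the
slice fields `u(s,·)`, `θ(s,·)`:  `(N+1)⁻¹ ∫₀ᵗ H(μ_s | localGibbsLaw σ (b s) (u s) (θ s)) ds → 0`  (lower Lebesgue integral of `klDiv` in `s`). -/
def KLIntegratedVanishAt (σ : ℝ) (a₀ θ₀ : T3 → ℝ) (u₀ : T3 → V3) (b θ : ℝ → T3 → ℝ) (u : ℝ → T3 → V3) (Φ : Flows σ) (t : ℝ) : Prop :=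
  Tendsto (fun N : ℕ => (∫⁻ s in Icc 0 t, InformationTheory.klDiv ((Φ N).lawAt (localGibbsLaw σ a₀ u₀ θ₀ N (Φ N)) s)
    (localGibbsLaw σ (b s) (u s) (θ s) N (Φ N))) / ((N : ℝ≥0∞) + 1)) atTop (𝓝 0)

/-- The slice activity `a_s(x) = exp(λ₀(s,x) + |u(s,x)|²/(2θ(s,x)))·(2πθ(s,x))^{3/2}` of the fields `(ρ, u, θ)`: the activity for which
`localGibbsProfile (sliceAct … s) (u s) (θ s) = exp ∘ tiltExponent … s` (`log_localGibbsProfile_slice`), i.e. whose local Gibbs law is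
the tilted reference `G_s`; `= (2π)^{3/2} e^{5/2} · ρ_s e^{f_ex(ρ_sσ³) + ρ_sσ³ f_ex'(ρ_sσ³)}`. -/
def sliceAct (σ : ℝ) (ρ θ : ℝ → T3 → ℝ) (u : ℝ → T3 → V3) (s : ℝ) (x : T3) : ℝ :=
  Real.exp (lam0 σ (ρ s x) (θ s x) (u s x) + ‖u s x‖ ^ 2 / (2 * θ s x)) * (2 * Real.pi * θ s x) ^ ((3 : ℝ) / 2)

/-- `BracketIntegratedVanishAt` — RATE-FREE STATICS + ISENTROPY, time-integrated: the bracket of the line's identity,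
`log Z_N(Λ_s) − S(μ₀) − (N+1) m_s`, is `o(N)` in `L¹(0,t)`:  `(N+1)⁻¹ ∫₀ᵗ |log Z_N(Λ_s) − S(μ₀) − (N+1)m_s| ds → 0`.  TRUE and provable
from the landed thermodynamic limits (`hardSphereLDA_proof` (B1) for the slice activity, the time-zero entropy limit of `JaynesSqueeze*`,
`…FibreIsentropy.integral_density_mul_entropy_eq`, mass conservation) for classical solutions in the dilute chamber. -/
def BracketIntegratedVanishAt (σ : ℝ) (a₀ θ₀ : T3 → ℝ) (u₀ : T3 → V3) (ρ θ : ℝ → T3 → ℝ) (u : ℝ → T3 → V3) (t : ℝ) : Prop :=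
  Tendsto (fun N : ℕ => ∫⁻ s in Icc 0 t, ENNReal.ofReal (((N : ℝ) + 1)⁻¹ *
    |Real.log (tiltZ σ ρ θ u N s).toReal - gibbsEntropy σ a₀ u₀ θ₀ N - ((N : ℝ) + 1) * tiltMean σ ρ θ u s|)) atTop (𝓝 0)

/-- `LinStatL1VanishAt` — RATE-FREE HYDRODYNAMIC INPUT, time-integrated `L¹`: `∫₀ᵗ E_N |ℓ_s ∘ Φ_s| ds → 0` (the five Λ-tested linear
statistics of the evolved gas converge in the mean, on average over `[0, t]`); implied by convergence in probability of the empirical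
fields at each `s ≤ t` (`TendstoHydroFieldsAt … s`) plus uniform integrability (`EnergyMomentAt`, energy conservation). -/
def LinStatL1VanishAt (σ : ℝ) (a₀ θ₀ : T3 → ℝ) (u₀ : T3 → V3) (ρ θ : ℝ → T3 → ℝ) (u : ℝ → T3 → V3) (Φ : Flows σ) (t : ℝ) : Prop :=
  Tendsto (fun N : ℕ => ∫⁻ s in Icc 0 t, ∫⁻ z, ENNReal.ofReal |linStat σ ρ θ u s ((Φ N).flow s z)|
    ∂(localGibbsLaw σ a₀ u₀ θ₀ N (Φ N))) atTop (𝓝 0)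


/-- The slice activity is positive wherever `θ > 0` (registered sub-goal `sliceAct_pos_of_pos`: the vocabulary file's obligation). -/
theorem sliceAct_pos_of_pos : ∀ (σ : ℝ) (ρ θ : ℝ → T3 → ℝ) (u : ℝ → T3 → V3) (s : ℝ) (x : T3), 0 < θ s x → 0 < sliceAct σ ρ θ u s x := by
  intro σ ρ θ u s x hθ
  exact mul_pos (Real.exp_pos _) (Real.rpow_pos_of_pos (mul_pos (mul_pos two_pos Real.pi_pos) hθ) _)

/-- `FarTailAllAt` implies `FarTailAt` (with `r = 0`, `K₀ = 0`). -/
theorem FarTailAllAt.farTailAt {σ : ℝ} {a₀ θ₀ : T3 → ℝ} {u₀ : T3 → V3} {Φ : Flows σ} {t : ℝ}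
    (h : FarTailAllAt σ a₀ θ₀ u₀ Φ t) : FarTailAt σ a₀ θ₀ u₀ Φ t := by
  obtain ⟨Θ, A, hΘ, N₀, hN⟩ := h
  refine ⟨Θ, A, 0, 0, hΘ, N₀, fun N hNN K _ => ?_⟩
  have h1 := hN N hNN K
  simpa only [Real.rpow_zero, mul_one] using h1

end Summit.AtomisticToContinuum.HydrodynamicLimit.Theorems.FibreDeficitTransfer

end
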